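import Summits.BirchSwinnertonDyer.BirchSwinnertonDyer.Theorems.KolyvaginRoadThreeMethod2LevelSystems
import Literature.NumberTheory.EllipticCurves.CasselsTateSelmerKolyvaginValue
import Literature.NumberTheory.GaloisRepresentations.LocalGlobalCohomology
import HarnessLib

/-!
# KOLY method line, crux stmt-BirchSwinnertonDyer-19574 `ZhangSharpFrameAtThreeHL`: the PER-PLACE DICTIONARIES of the
# S2-ENGINE work package for the GENUINE localisation maps (cell `bsd-stepL`, seat `bsd-stepL-zhang3-p1` g8;
# `--supports 19574`, helper; v3 re-line, memo `HOME/zhang3/S2-RELINE-19574.md` §2 items 1–2)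

`Method2.inductionOfLevelSystems_of_dictionaries` (p499103) takes five per-place dictionaries between the tree's GLOBAL
Gross-currency local conditions (`torsionLocalKer`, `selmerLocalKer`, `ordinaryLocalKer`, `Method2.transverseLocalKer`:
subgroups of `H¹(K, E[3])`) and subspaces of abstract local spaces along abstract localisations. This file proves them,
in additive currency, for the GENUINE localisation `galoisCohomology.localization ρ v 1 : H¹(K, E[3]) →+ H¹(K_v, E[3])`
(`ρ = (E/K).torsionGaloisModule 3`, `K_v = Place.Completion v`) — the engine's `loc v` is its `ZMod 3`-linear version
(`AddMonoidHom.toZModLinearMap`): strict vanishing = kernel (tree `mem_torsionLocalKer_iff_res_eq_zero`: `E(K̄)[3] ⥲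
E(K̄_v)[3]`); Kummer = preimage of the genuine local Kummer condition `kummerLocalConditionAt` (tree
`comap_res_kummerLocalConditionAt`); ordinary and transverse = preimages of their own images (both contain the kernel —
for the transverse condition this inclusion is kept as a hypothesis, to be proved from the vanishing of the cocycle on
the decomposition groups); the eigenspace dictionary for `ker(τ − sgn s)`. 0 definitions, 0 facts, 0 `sorry`; closes
nothing (T7).

References: [cite: WZhang2014, §5, §8.1] [cite: SilvermanAEC2009, X.§4, Cor. III.6.4(b)]
[cite: McCallumLMS1991, §3 (3)].
-/

noncomputable section

open scoped Classical

namespace Summit.BirchSwinnertonDyer.Rank1Residual.X11b.Three.Koly.Method2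

open WeierstrassCurve NumberField IsDedekindDomain
  Literature.NumberTheory.EllipticCurves Literature.NumberTheory.EllipticCurves.ModularForms
  Literature.NumberTheory.GaloisRepresentations Module

/-- **A subgroup containing the kernel is the preimage of its image.** [folklore] -/
theorem mem_iff_apply_mem_map_of_ker_le {A B : Type*} [AddCommGroup A] [AddCommGroup B] (f : A →+ B)
    {H : AddSubgroup A} (hker : f.ker ≤ H) (x : A) : x ∈ H ↔ f x ∈ H.map f := by
  refine ⟨fun hx ↦ AddSubgroup.mem_map_of_mem f hx, fun hx ↦ ?_⟩
  obtain ⟨y, hy, hyx⟩ := AddSubgroup.mem_map.mp hx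
  have hk : x - y ∈ f.ker := by rw [AddMonoidHom.mem_ker, map_sub, hyx, sub_self]
  have := H.add_mem (hker hk) hy
  rwa [sub_add_cancel] at this

variable (W : WeierstrassCurve ℚ) (K : Type) [Field K] [NumberField K] [W.IsElliptic]

/-- **Strict vanishing = kernel of the genuine localisation** at a finite place `v`:
`x ∈ torsionLocalKer_v ⟺ loc_v x = 0`
in `H¹(K_v, E[3])` (tree `mem_torsionLocalKer_iff_res_eq_zero`; `E(K̄)[3] ⥲ E(K̄_v)[3]`). The dictionary `hZero` of
`inductionOfLevelSystems_of_dictionaries`. [cite: McCallumLMS1991, §3 (3)] [cite: SilvermanAEC2009, Cor. III.6.4(b)] -/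
theorem mem_torsionLocalKer_iff_localization_eq_zero (v : HeightOneSpectrum (𝓞 K)) (x : V3 W K) :
    x ∈ (W.baseChange K).torsionLocalKer (v.adicCompletion K) ((3 ^ 1 : ℕ) : ℤ) ↔
      galoisCohomology.localization ((W.baseChange K).torsionGaloisModule ((3 ^ 1 : ℕ) : ℤ)) (Sum.inr v) 1 x = 0 := by
  haveI : CharZero (v.adicCompletion K) :=
    charZero_of_injective_algebraMap (algebraMap K (v.adicCompletion K)).injective
  exact mem_torsionLocalKer_iff_res_eq_zero (W.baseChange K) (v.adicCompletion K) (k := 3 ^ 1) (by norm_num) x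

/-- The kernel of the genuine localisation at a finite place IS `torsionLocalKer`. [folklore] -/
theorem ker_localization_eq_torsionLocalKer (v : HeightOneSpectrum (𝓞 K)) :
    (galoisCohomology.localization ((W.baseChange K).torsionGaloisModule ((3 ^ 1 : ℕ) : ℤ)) (Sum.inr v) 1).ker =
      (W.baseChange K).torsionLocalKer (v.adicCompletion K) ((3 ^ 1 : ℕ) : ℤ) := by
  ext x
  exact (mem_torsionLocalKer_iff_localization_eq_zero W K v x).symm

omit [W.IsElliptic] in
/-- **Kummer = preimage of the genuine local Kummer condition**, finite place: `x ∈ selmerLocalKer_v ⟺ loc_v x ∈ 𝓛_v`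
(`𝓛_v = kummerLocalConditionAt`, tree `comap_res_kummerLocalConditionAt`). The dictionary `hKumFin`.
[cite: SilvermanAEC2009, X.§4] -/
theorem mem_selmerLocalKer_iff_localization_mem_kummer (v : HeightOneSpectrum (𝓞 K)) (x : V3 W K) :
    x ∈ selmerLocalKer (W.baseChange K) (v.adicCompletion K) ((3 ^ 1 : ℕ) : ℤ) ↔
      galoisCohomology.localization ((W.baseChange K).torsionGaloisModule ((3 ^ 1 : ℕ) : ℤ)) (Sum.inr v) 1 x ∈
        (W.baseChange K).kummerLocalConditionAt ((3 ^ 1 : ℕ) : ℤ) (v.adicCompletion K) := by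
  exact (SetLike.ext_iff.mp
    ((W.baseChange K).comap_res_kummerLocalConditionAt ((3 ^ 1 : ℕ) : ℤ) (v.adicCompletion K)) x).symm

omit [W.IsElliptic] in
/-- **Kummer = preimage of the genuine local Kummer condition**, infinite place. The dictionary `hKumInf`.
[cite: SilvermanAEC2009, X.§4] -/
theorem mem_selmerLocalKer_iff_localization_mem_kummer_inf (w : InfinitePlace K) (x : V3 W K) :
    x ∈ selmerLocalKer (W.baseChange K) w.Completion ((3 ^ 1 : ℕ) : ℤ) ↔
      galoisCohomology.localization ((W.baseChange K).torsionGaloisModule ((3 ^ 1 : ℕ) : ℤ)) (Sum.inl w) 1 x ∈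
        (W.baseChange K).kummerLocalConditionAt ((3 ^ 1 : ℕ) : ℤ) w.Completion := by
  exact (SetLike.ext_iff.mp
    ((W.baseChange K).comap_res_kummerLocalConditionAt ((3 ^ 1 : ℕ) : ℤ) w.Completion) x).symm

/-- **Ordinary = preimage of its own image** under the genuine localisation at a finite place (it contains the kernel).
The dictionary `hOrd` with `Ord v := (ordinaryLocalKer_v).map loc_v`. [cite: BertoliniDarmon2005, §2.2] -/
theorem mem_ordinaryLocalKer_iff_localization_mem_map (v : HeightOneSpectrum (𝓞 K)) (x : V3 W K) :
    x ∈ (W.baseChange K).ordinaryLocalKer (v.adicCompletion K) ((3 ^ 1 : ℕ) : ℤ) ↔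
      galoisCohomology.localization ((W.baseChange K).torsionGaloisModule ((3 ^ 1 : ℕ) : ℤ)) (Sum.inr v) 1 x ∈
        ((W.baseChange K).ordinaryLocalKer (v.adicCompletion K) ((3 ^ 1 : ℕ) : ℤ)).map
          (galoisCohomology.localization ((W.baseChange K).torsionGaloisModule ((3 ^ 1 : ℕ) : ℤ)) (Sum.inr v) 1) := by
  -- `torsionLocalKer ≤ ordinaryLocalKer`: the zero local class is represented by the zero cocycle (fixed values)
  have hle : (W.baseChange K).torsionLocalKer (v.adicCompletion K) ((3 ^ 1 : ℕ) : ℤ) ≤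
      (W.baseChange K).ordinaryLocalKer (v.adicCompletion K) ((3 ^ 1 : ℕ) : ℤ) := by
    intro y hy
    change (W.baseChange K).torsionLocMap (v.adicCompletion K) _ y = 0 at hy
    change y ∈ AddSubgroup.comap _ _
    rw [AddSubgroup.mem_comap, hy]
    exact AddSubgroup.zero_mem _
  exact mem_iff_apply_mem_map_of_ker_le _ ((ker_localization_eq_torsionLocalKer W K v).le.trans hle) x

/-- **Transverse = preimage of its own image** under the genuine localisation at the place of a Kolyvagin prime, GIVEN
`torsionLocalKer ≤ transverseLocalKer` there (a class with zero localisation has a cocycle vanishing on the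
decomposition
groups — to be proved; hypothesis here). The dictionary `hTr` with `Tr ℓ := (transverseLocalKer).map loc`.
[cite: WZhang2014, §8.1 (H¹_tr)] -/
theorem mem_transverseLocalKer_iff_localization_mem_map (ι : K →+* ℂ) (ℓ : ℕ) (v : HeightOneSpectrum (𝓞 K))
    (htr0 : (W.baseChange K).torsionLocalKer (v.adicCompletion K) ((3 ^ 1 : ℕ) : ℤ) ≤ transverseLocalKer W K ι ℓ v)
    (x : V3 W K) :
    x ∈ transverseLocalKer W K ι ℓ v ↔
      galoisCohomology.localization ((W.baseChange K).torsionGaloisModule ((3 ^ 1 : ℕ) : ℤ)) (Sum.inr v) 1 x ∈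
        (transverseLocalKer W K ι ℓ v).map
          (galoisCohomology.localization ((W.baseChange K).torsionGaloisModule ((3 ^ 1 : ℕ) : ℤ)) (Sum.inr v) 1) :=
  mem_iff_apply_mem_map_of_ker_le _ ((ker_localization_eq_torsionLocalKer W K v).le.trans htr0) x

omit [W.IsElliptic] in
/-- **The eigenspace dictionary**: membership in `ker(τ − sgn s)` (as a `ZMod 3`-subspace) is `τ x = sgn s • x`. The
dictionary `hE` with `E s := toZModSubmodule 3 (ker(conjAct − sgn s • id))`. [cite: GrossLMS1991, §5 (5.1)] -/
theorem mem_eigenSubmodule_iff (c : K ≃ₐ[ℚ] K) [Module (ZMod 3) (V3 W K)] (s : Bool) (x : V3 W K) :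
    x ∈ AddSubgroup.toZModSubmodule 3 (conjAct W c ((3 ^ 1 : ℕ) : ℤ) - sgn s • AddMonoidHom.id (V3 W K)).ker ↔
      conjAct W c ((3 ^ 1 : ℕ) : ℤ) x = sgn s • x := by
  rw [AddSubgroup.mem_toZModSubmodule, AddMonoidHom.mem_ker, AddMonoidHom.sub_apply, sub_eq_zero]
  rfl

end Summit.BirchSwinnertonDyer.Rank1Residual.X11b.Three.Koly.Method2

end
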